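import Summits.ValiantsHypothesis.ValiantsHypothesis.Theses.GrenetZeon
import Literature.Computability.AlgebraicComplexity.AlgDetRepr
import Literature.Computability.AlgebraicComplexity.StandardFamiliesProofs

/-!
# Skeleton line `transfer-mv-unroll` for the piece `TransferToDc` (stmt-ValiantsHypothesis-8069)
# of the decomposition `AlgDcQP ⇐ TransferToDc ∧ AbelianizationQP ∧ PolySizeQPAlgebra`

`TransferToDc`: an `(m, s)`-representation of `per_n` (an `m × m` affine matrix `A` over `R[x]`,
`R` a commutative ℂ-algebra of dimension `≤ s`, read through a functional `λ`) gives an ordinary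
affine determinantal representation of size `(s + 1)(m + 1)^3`.

Line (Mahajan–Vinay 1997 §3–4; Ikenmeyer–Landsberg 2017 Thm. 4.1; Hrubeš–Yehudayoff 2011 Thm. 4.2):
* `stub_mvDetABP` — UNIFORM DIVISION-FREE DETERMINANT: over every commutative ring `S`, `det A`
  is the `(a, b)` path series `adj(1 - N)_{ab}` of a nilpotent (strictly upper-triangular)
  transition matrix `N` of size `V ≤ (m + 1)^3` whose entries are `0`, `±1` or `±` entries of `A`
  (the clow-sequence branching program; `V ≈ m³/2`).
* `stub_regularUnroll` — REGULAR-REPRESENTATION UNROLLING: a nilpotent affine transition matrix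
  over `R[x]` of size `V`, read through `λ`, becomes one over `ℂ[x]` of size `≤ (dim R)·V + 1`
  (substitute the `s × s` blocks `ρ(N_ij)ᵀ` of the regular representation in a basis `e₁ = 1_R, …`
  — `R` is commutative, so `r ↦ ρ(r)ᵀ` is multiplicative too — and add one `λ`-sink collecting
  `(b, α)` with weight `λ(e_α)`; start at `(a, 1)`), with
  `coeff_d adj(1 - N')_{a'b'} = λ (coeff_d adj(1 - N)_{ab})`.
* `TransferToDc_of` — composition (proved): entries `0, ±1, ±A_pq` are affine; the zero ring is
  excluded by `per_n ≠ 0`; an adjugate entry of an affine matrix is an affine determinant of the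
  same size (`Matrix.adjugate_apply`: replace row `b'` by a unit vector); pad
  `s (m+1)^3 + 1 ≤ (s+1)(m+1)^3` (`HasDetRepr.mono_holds`).
-/

noncomputable section

set_option linter.dupNamespace false

namespace Summit.ValiantsHypothesis.ValiantsHypothesis.Cruxes.TransferToDc.MvUnroll

open MvPolynomial Matrix
open Literature.Computability.AlgebraicComplexity
open Summit.ValiantsHypothesis.ValiantsHypothesis.Theses.GrenetZeon

/-- **Stub 1 (Mahajan–Vinay uniform division-free determinant).** Over any commutative ring `S`,
the determinant of an `m × m` matrix `A` is the `(a, b)` entry of `adj(1 - N)` (= the sum over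
`a → b` paths of the products of the labels, since `det (1 - N) = 1`) for a strictly
upper-triangular `V × V` matrix `N` whose entries are `0`, `±1` or `±` entries of `A`, with
`V ≤ (m + 1)^3` (clow sequences with a head and a current vertex, layered by length:
`V ≤ m³/2 + O(m²)`; Ikenmeyer–Landsberg 2017 Thm. 4.1 counts `m³/3 - m/3 + 2`).
Mahajan–Vinay 1997, Thm. 3 / §4. Size: M. -/
theorem stub_mvDetABP (S : Type*) [CommRing S] (m : ℕ) (A : Matrix (Fin m) (Fin m) S) :
    ∃ (V : ℕ) (N : Matrix (Fin V) (Fin V) S) (a b : Fin V),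
      V ≤ (m + 1) ^ 3 ∧
      (∀ i j, N i j = 0 ∨ N i j = 1 ∨ N i j = -1 ∨ ∃ p q, N i j = A p q ∨ N i j = -A p q) ∧
      (∀ i j, j ≤ i → N i j = 0) ∧
      (1 - N).adjugate a b = A.det := by
  sorry

/-- **Stub 2 (regular-representation unrolling, Hrubeš–Yehudayoff accounting for branching
programs).** Let `R` be a nonzero commutative ℂ-algebra, finite-dimensional, `λ : R → ℂ` linear,
and `N` a strictly upper-triangular `V × V` matrix of affine forms over `R`. Choose a ℂ-basis
`e₁ = 1_R, e₂, …, e_s` of `R`; let `ρ(r)` be the matrix of multiplication by `r`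
(`r e_β = Σ_α ρ(r)_{αβ} e_α`). Replacing every entry `N_ij = Σ_d c_d x^d` by the `s × s` block
`(ρ(c_d)ᵀ)` (coefficientwise; `r ↦ ρ(r)ᵀ` is multiplicative because `R` is commutative) gives a
strictly upper-triangular affine matrix over `ℂ` on `V·s` vertices whose path series from `(a, 1)`
to `(b, α)` is `ρ(P)_{α 1}` for `P = adj(1 - N)_{ab}` (coefficientwise), and
`λ(P) = λ(P · e₁) = Σ_α ρ(P)_{α1} λ(e_α)`: one extra sink collecting `(b, α)` with weight `λ(e_α)`
reads off `λ`. Size `≤ s V + 1`, and `coeff_d adj(1 - N')_{a' b'} = λ (coeff_d adj(1 - N)_{a b})`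
with `a' = (a, 1)`, `b'` = the sink. Size: M. -/
theorem stub_regularUnroll (R : Type) [CommRing R] [Algebra ℂ R] [Module.Finite ℂ R] [Nontrivial R]
    (l : R →ₗ[ℂ] ℂ) {σ : Type} (V : ℕ) (N : Matrix (Fin V) (Fin V) (MvPolynomial σ R))
    (a b : Fin V) (hN : ∀ i j, (N i j).totalDegree ≤ 1) (hU : ∀ i j, j ≤ i → N i j = 0) :
    ∃ (V' : ℕ) (N' : Matrix (Fin V') (Fin V') (MvPolynomial σ ℂ)) (a' b' : Fin V'),
      V' ≤ Module.finrank ℂ R * V + 1 ∧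
      (∀ i j, (N' i j).totalDegree ≤ 1) ∧ (∀ i j, j ≤ i → N' i j = 0) ∧
      ∀ d : σ →₀ ℕ, MvPolynomial.coeff d ((1 - N').adjugate a' b') =
        l (MvPolynomial.coeff d ((1 - N).adjugate a b)) := by
  sorry

/-! ### Proved glue -/

/-- Entries `0, ±1, ± A_pq` of the Mahajan–Vinay transition matrix are affine when `A` is. -/
theorem affine_of_entries {σ S : Type*} [CommRing S] {m V : ℕ}
    {A : Matrix (Fin m) (Fin m) (MvPolynomial σ S)} (hA : ∀ i j, (A i j).totalDegree ≤ 1)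
    {N : Matrix (Fin V) (Fin V) (MvPolynomial σ S)}
    (hN : ∀ i j, N i j = 0 ∨ N i j = 1 ∨ N i j = -1 ∨ ∃ p q, N i j = A p q ∨ N i j = -A p q)
    (i j : Fin V) : (N i j).totalDegree ≤ 1 := by
  rcases hN i j with h | h | h | ⟨p, q, h | h⟩
  · rw [h, totalDegree_zero]; exact Nat.zero_le _
  · rw [h, totalDegree_one]; exact Nat.zero_le _
  · rw [h, totalDegree_neg, totalDegree_one]; exact Nat.zero_le _
  · rw [h]; exact hA p q
  · rw [h, totalDegree_neg]; exact hA p q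

/-- An adjugate entry of an affine `V × V` matrix `1 - N'` is an affine determinant of size `V`
(`Matrix.adjugate_apply`: replace row `b'` by the unit vector `e_{a'}`). -/
theorem hasDetRepr_adjugate_entry {σ : Type*} {V : ℕ}
    (N' : Matrix (Fin V) (Fin V) (MvPolynomial σ ℂ)) (hN' : ∀ i j, (N' i j).totalDegree ≤ 1)
    (a' b' : Fin V) : HasDetRepr ((1 - N').adjugate a' b') V := by
  refine ⟨(1 - N').updateRow b' (Pi.single a' 1), fun i j => ?_, (Matrix.adjugate_apply _ _ _).symm⟩
  rw [Matrix.updateRow_apply]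
  split_ifs with hi
  · rw [Pi.single_apply]
    split_ifs
    · rw [totalDegree_one]; exact Nat.zero_le _
    · rw [totalDegree_zero]; exact Nat.zero_le _
  · rw [Matrix.sub_apply, Matrix.one_apply]
    refine (totalDegree_sub _ _).trans (max_le ?_ (hN' i j))
    split_ifs
    · rw [totalDegree_one]; exact Nat.zero_le _
    · rw [totalDegree_zero]; exact Nat.zero_le _

/-- **Composition (proved): `TransferToDc` from the two stubs.** -/
theorem TransferToDc_of : TransferToDc := by
  intro n m s hrep
  obtain ⟨R, _, _, _, hR, l, A, hA, hf⟩ := hrep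
  -- the zero ring represents only the zero polynomial, and `per_n ≠ 0`
  rcases subsingleton_or_nontrivial R with hRs | hRn
  · exfalso
    refine perPoly_ne_zero (Fin n) ℂ (MvPolynomial.ext _ _ fun d => ?_)
    rw [← hf d, Subsingleton.elim (MvPolynomial.coeff d A.det) 0, map_zero, coeff_zero]
  -- Mahajan–Vinay over `R[x]`
  obtain ⟨V, N, a, b, hV, hNe, hNu, hdet⟩ := stub_mvDetABP (MvPolynomial (Fin n × Fin n) R) m A
  have hNa : ∀ i j, (N i j).totalDegree ≤ 1 := affine_of_entries hA hNe
  -- unroll the coefficient algebra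
  obtain ⟨V', N', a', b', hV', hN'a, -, hcoeff⟩ := stub_regularUnroll R l V N a b hNa hNu
  have hper : (1 - N').adjugate a' b' = perPoly (Fin n) ℂ :=
    MvPolynomial.ext _ _ fun d => by rw [hcoeff d, hdet, hf d]
  have hrepr : HasDetRepr (perPoly (Fin n) ℂ) V' := hper ▸ hasDetRepr_adjugate_entry N' hN'a a' b'
  -- pad to `(s + 1) (m + 1)^3`
  refine HasDetRepr.mono_holds hrepr ?_
  calc V' ≤ Module.finrank ℂ R * V + 1 := hV'
    _ ≤ s * (m + 1) ^ 3 + (m + 1) ^ 3 :=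
        Nat.add_le_add (Nat.mul_le_mul hR hV) (Nat.one_le_pow _ _ (Nat.succ_pos m))
    _ = (s + 1) * (m + 1) ^ 3 := by ring

end Summit.ValiantsHypothesis.ValiantsHypothesis.Cruxes.TransferToDc.MvUnroll
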